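import Mathlib
import HarnessLib
import Summits.ABC.ABC.Theses.CongruentialReceptacle
import Summits.ABC.ABC.Theorems.CompactBalanceTransfer.Negative.CuspWeightedResidueFree
import Summits.ABC.ABC.Theorems.ReceptacleIdentity.Negative.TameLocalReceptacleResidueFreeLemmas

/-!
# Crux `ReceptacleIdentity` (stmt-ABC-1813) through its typed face `TameLocalReceptacle` (stmt-ABC-14354):
# the RESIDUE-FREE tame-local receptacle is false on the compactly balanced cell

Negative lemma for the crux chain of route `CongruentialReceptacle` (crux disprover
`refuter-cdisprove-stmt-ABC-1813-0`, 2026-08-16). The informal rank-2 crux `ReceptacleIdentity` has no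
Lean declaration; its typed face `Summit.ABC.ABC.Theses.CongruentialReceptacle.TameLocalReceptacle` asks,
for all `κ, ε > 0`, for constants `c₁ > 0, c₁′, c₃, m₀` and, for every prime power `ℓⁿ ≥ m₀` (`ℓ ≥ 5`), an
INTEGER table `t(p; v_p a, v_p b, v_p c; a′, b′, c′ mod p)` with windows
`c₁ (2(v_p a + v_p b + v_p c) − 6 − ε) log p ≤ t`, `|t| ≤ c₁′ (v_p a + v_p b + v_p c + 1) log p`, and
`Σ_{p ∣ abc} t ≡ B (mod ℓⁿ)`, `|B| ≤ c₃`, on every `κ`-balanced abc-triple prime to `ℓ`. The route's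
cheapest falsifier predicted that RESIDUE-FREE tables `t(p; v_p a, v_p b, v_p c)` die by a
Turán–Kubilius/Elliott averaging over the families {squarefree}, {a = 2ⁿ}, {b = 2ⁿ}, {c = 2ⁿ}. Here the
residue-free statement is refuted WITHOUT averaging, by an explicit certificate on the balanced cell
(`tameLocal_residueFree_false`: every `κ ≤ 2⁻²⁵`, every `ε < 2`, all constants;
`not_tameLocalReceptacle_residueFree`: the literal negation of the residue-free variant).

## Certificate

Primes `7 ≤ r < q ≤ 2r` (Bertrand) with `c₁ (2 − ε) log r > 3c₃`; `X = r⁴`, `W = q⁴`, `y = 15W − X`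
(even, `≡ −1 mod 15`); a prime `s ∤ y` with `2y < s⁴ ≤ 2²¹ y` (one of four Bertrand primes above
`(2y)^{1/4}`); `Y = s⁴`, `u = Y − y` (odd, prime to `15`), `x = 15u − y`. The abc-triples
`T⁻ = (x, y, 15u)`, `T₁⁺ = (x, Y, 16u)`, `T₂⁺ = (X, y, 15W)` are `2⁻²⁵`-balanced and share their members
position by position up to fourth powers, so
`S(T₁⁺) + S(T₂⁺) − S(T⁻) = t(s;0,4,0) + t(2;0,0,4) + t(r;4,0,0) + t(q;0,0,4) ≥ c₁ (2 − ε) log r`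
by the LOWER window at valuation `4` alone; at one prime modulus `ℓ` above the three products, `m₀` and
the a-priori upper-window bounds the congruences are identities with `|Bᵢ| ≤ c₃` (congruence to
equality, `CompactBalanceTransfer.Negative.eq_of_modEq_of_abs_le` of the sibling crux), whence `≤ 3c₃`: false.

## Scope

Not refuted: the residue-dependent `TameLocalReceptacle` itself. With residues the shared members stop
cancelling (at `p ∣ x` the table sees `b mod p`, which is `y` in `T⁻` and `16y` in `T₁⁺`; matching all
residues forces S-unit members). The crux work file `Cruxes/ReceptacleIdentity/Disproof.lean` records why
no family-averaging argument can refute the residue-dependent statement either (sparse-residue entries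
of size `≍ c₁′ ×` entropy deficit beat the `2c₁ ×` signal, and `c₁′ ≥ 2c₁` is forced by the windows).
-/

set_option linter.dupNamespace false

namespace Summit.ABC.ABC.Theorems.ReceptacleIdentity.Negative

open Literature.NumberTheory.DiophantineGeometry

/-! ### The residue-free balanced receptacle is false -/

set_option maxHeartbeats 1600000 in
/-- **Core refutation.** For every balance `κ ≤ 2⁻²⁵`, every `ε < 2` and all constants `c₁ > 0`, `c₁'`,
`c₃`, `m₀`: there is no family of RESIDUE-FREE integer tables `t(p; v_p a, v_p b, v_p c)` with the
tame-local windows `c₁ (2(i+j+k) − 6 − ε) log p ≤ t`, `|t| ≤ c₁' (i+j+k+1) log p` whose sum over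
`p ∣ abc` is `≡ B (mod ℓⁿ)`, `|B| ≤ c₃`, on every `κ`-balanced abc-triple prime to `ℓ` (for all prime
powers `ℓⁿ ≥ m₀`, `ℓ ≥ 5`).

Certificate (three balanced triples sharing members position by position): with primes `7 ≤ r < q ≤ 2r`,
`X = r⁴`, `W = q⁴`, `y = 15W − X`, a prime `s ∤ y` with `2y < s⁴ ≤ 2²¹ y`, `Y = s⁴`, `u = Y − y`,
`x = 15u − y`, the triples `T⁻ = (x, y, 15u)`, `T₁⁺ = (x, Y, 16u)`, `T₂⁺ = (X, y, 15W)` are abc-triples,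
`2⁻²⁵`-balanced, and `S(T₁⁺) + S(T₂⁺) − S(T⁻) = t(s;0,4,0) + t(2;0,0,4) + t(r;4,0,0) + t(q;0,0,4)`,
each term `≥ c₁ (2 − ε) log p ≥ 0` by the lower window at valuation `4`; read at one prime modulus `ℓ`
above everything the three congruences are identities in `ℤ`, so this is `≤ 3c₃` — false once
`c₁ (2 − ε) log r > 3 c₃`. [folklore] -/
theorem tameLocal_residueFree_false (κ ε c₁ c₁' c₃ : ℝ) (hκ : κ ≤ 1 / 2 ^ 25) (hε : ε < 2)
    (hc₁ : 0 < c₁) (m₀ : ℕ)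
    (H : ∀ ℓ n : ℕ, ℓ.Prime → 5 ≤ ℓ → m₀ ≤ ℓ ^ n →
      ∃ t : ℕ → ℕ → ℕ → ℕ → ℤ,
        (∀ p i j k : ℕ, p.Prime →
          c₁ * (2 * ((i + j + k : ℕ) : ℝ) - 6 - ε) * Real.log p ≤ (t p i j k : ℝ) ∧
          |(t p i j k : ℝ)| ≤ c₁' * (((i + j + k : ℕ) : ℝ) + 1) * Real.log p) ∧
        ∀ a b c : ℕ, IsABCTriple a b c → κ * (c : ℝ) ≤ (a : ℝ) → κ * (c : ℝ) ≤ (b : ℝ) →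
          ¬ ℓ ∣ a * b * c → ∃ B : ℤ, |(B : ℝ)| ≤ c₃ ∧
            (∑ p ∈ (a * b * c).primeFactors,
              t p (a.factorization p) (b.factorization p) (c.factorization p)) ≡
              B [ZMOD ((ℓ ^ n : ℕ) : ℤ)]) :
    False := by
  -- constants
  set K : ℝ := max c₁' 0 with hK
  have hK0 : 0 ≤ K := le_max_right _ _
  have hK1 : c₁' ≤ K := le_max_left _ _
  have h2ε : 0 < 2 - ε := by linarith
  have hcε : 0 < c₁ * (2 - ε) := mul_pos hc₁ h2ε
  -- balance dispatcher: `c ≤ 2^25 a` in `ℕ` gives `κ c ≤ a`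
  have bal : ∀ {a c : ℕ}, c ≤ 2 ^ 25 * a → κ * (c : ℝ) ≤ (a : ℝ) := by
    intro a c h
    have h' : (c : ℝ) ≤ 2 ^ 25 * (a : ℝ) := by exact_mod_cast h
    have hc0 : (0 : ℝ) ≤ (c : ℝ) := Nat.cast_nonneg c
    calc κ * (c : ℝ) ≤ (1 / 2 ^ 25) * (c : ℝ) := mul_le_mul_of_nonneg_right hκ hc0
      _ ≤ (a : ℝ) := by rw [one_div, inv_mul_le_iff₀ (by positivity)]; exact h'
  -- Step 1: a prime r ≥ 7 with c₁ (2 - ε) log r > 3 c₃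
  set A : ℝ := 3 * c₃ / (c₁ * (2 - ε)) with hA
  obtain ⟨r, hrge, hr⟩ := Nat.exists_infinite_primes (⌈Real.exp A⌉₊ + 7)
  have hr7 : 7 ≤ r := le_trans (Nat.le_add_left 7 _) hrge
  have hrA : A < Real.log r := by
    rw [Real.lt_log_iff_exp_lt (by positivity)]
    calc Real.exp A ≤ ⌈Real.exp A⌉₊ := Nat.le_ceil _
      _ < (⌈Real.exp A⌉₊ : ℝ) + 7 := by linarith
      _ = ((⌈Real.exp A⌉₊ + 7 : ℕ) : ℝ) := by push_cast; ring
      _ ≤ (r : ℝ) := by exact_mod_cast hrge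
  have hr3A : 3 * c₃ < c₁ * (2 - ε) * Real.log r := by
    have e : c₁ * (2 - ε) * A = 3 * c₃ := by
      rw [hA]; field_simp
    nlinarith [mul_lt_mul_of_pos_left hrA hcε]
  have hr2 : ¬ 2 ∣ r := fun h => by
    have := (Nat.prime_dvd_prime_iff_eq Nat.prime_two hr).mp h; omega
  have hr3 : ¬ 3 ∣ r := fun h => by
    have := (Nat.prime_dvd_prime_iff_eq Nat.prime_three hr).mp h; omega
  have hr5 : ¬ 5 ∣ r := fun h => by
    have := (Nat.prime_dvd_prime_iff_eq (by norm_num) hr).mp h; omega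
  -- Step 2: a Bertrand prime q with r < q ≤ 2r
  obtain ⟨q, hq, hrq, hq2r⟩ := Nat.exists_prime_lt_and_le_two_mul r (by omega)
  have hq2 : ¬ 2 ∣ q := fun h => by
    have := (Nat.prime_dvd_prime_iff_eq Nat.prime_two hq).mp h; omega
  -- X = r⁴, W = q⁴, y = 15 W − X
  set X : ℕ := r ^ 4 with hX
  set W : ℕ := q ^ 4 with hW
  have hX0 : 0 < X := pow_pos (by omega) 4
  have hXW : X < W := Nat.pow_lt_pow_left hrq (by norm_num)
  have hW16 : W ≤ 16 * X := by
    calc W = q ^ 4 := rfl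
      _ ≤ (2 * r) ^ 4 := Nat.pow_le_pow_left hq2r 4
      _ = 16 * r ^ 4 := by ring
  have hX2 : X % 2 = 1 := by
    rw [hX, Nat.pow_mod]; have e : r % 2 = 1 := by omega
    rw [e]
  have hW2 : W % 2 = 1 := by
    rw [hW, Nat.pow_mod]; have e : q % 2 = 1 := by omega
    rw [e]
  have hX3 : X % 3 = 1 := pow_four_mod_three hr3
  have hX5 : X % 5 = 1 := pow_four_mod_five hr5
  obtain ⟨y, hyX⟩ : ∃ y : ℕ, y + X = 15 * W := ⟨15 * W - X, Nat.sub_add_cancel (by omega)⟩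
  have hy14 : 14 * W ≤ y := by omega
  have hy0 : 0 < y := by omega
  have hy2 : y % 2 = 0 := by omega
  have hy3 : y % 3 = 2 := by omega
  have hy5 : y % 5 = 4 := by omega
  -- Step 3: a prime s ∤ y with 2y < s⁴ ≤ 2²¹ y
  obtain ⟨hn4, hn32⟩ := fourth_root_bounds hy0
  set n₀ : ℕ := Nat.sqrt (Nat.sqrt (2 * y)) + 1 with hn₀
  have hn₀2 : 2 ≤ n₀ := by
    have h1 : 1 ≤ Nat.sqrt (2 * y) := by rw [Nat.le_sqrt]; omega
    have h2 : 1 ≤ Nat.sqrt (Nat.sqrt (2 * y)) := by rw [Nat.le_sqrt]; omega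
    omega
  obtain ⟨s, hs, hns, hs16, hsy⟩ := exists_prime_not_dvd hy0 hn4 (by omega)
  have hs2 : ¬ 2 ∣ s := fun h => by
    have := (Nat.prime_dvd_prime_iff_eq Nat.prime_two hs).mp h; omega
  set Y : ℕ := s ^ 4 with hY
  have hyY : 2 * y < Y :=
    lt_of_lt_of_le hn4 (Nat.pow_le_pow_left hns.le 4)
  have hY21 : Y ≤ 2 ^ 21 * y := by
    calc Y = s ^ 4 := rfl
      _ ≤ (16 * n₀) ^ 4 := Nat.pow_le_pow_left hs16 4
      _ = 2 ^ 16 * n₀ ^ 4 := by ring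
      _ ≤ 2 ^ 16 * (32 * y) := by gcongr
      _ = 2 ^ 21 * y := by ring
  have hY2 : Y % 2 = 1 := by
    rw [hY, Nat.pow_mod]; have e : s % 2 = 1 := by omega
    rw [e]
  have hY3 : Y % 3 ≠ 2 := pow_four_mod_three_ne_two s
  have hY5 : Y % 5 ≤ 1 := pow_four_mod_five_le_one s
  -- u = Y − y, x = 15 u − y
  obtain ⟨u, hu⟩ : ∃ u : ℕ, u + y = Y := ⟨Y - y, Nat.sub_add_cancel (by omega)⟩
  have hyu : y < u := by omega
  have hu21 : u ≤ 2 ^ 21 * y := by omega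
  have hu2 : u % 2 = 1 := by omega
  have hu3 : u % 3 ≠ 0 := by omega
  have hu5 : u % 5 ≠ 0 := by omega
  obtain ⟨x, hx⟩ : ∃ x : ℕ, x + y = 15 * u := ⟨15 * u - y, Nat.sub_add_cancel (by omega)⟩
  have hx14 : 14 * u ≤ x := by omega
  have hx0 : 0 < x := by omega
  have hu0 : 0 < u := by omega
  have hxY : x + Y = 16 * u := by omega
  -- Step 4: coprimality
  have cop_s_y : Nat.Coprime s y := (Nat.Prime.coprime_iff_not_dvd hs).mpr hsy
  have cop_Y_y : Nat.Coprime Y y := Nat.Coprime.pow_left 4 cop_s_y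
  have cop_u_y : Nat.Coprime u y := Nat.coprime_add_self_left.mp (by rw [hu]; exact cop_Y_y)
  have h3y : ¬ 3 ∣ y := by omega
  have h5y : ¬ 5 ∣ y := by omega
  have cop_15_y : Nat.Coprime 15 y :=
    Nat.Coprime.mul_left ((Nat.Prime.coprime_iff_not_dvd Nat.prime_three).mpr h3y)
      ((Nat.Prime.coprime_iff_not_dvd (by norm_num)).mpr h5y)
  have cop_15u_y : Nat.Coprime (15 * u) y := Nat.Coprime.mul_left cop_15_y cop_u_y
  have cop_x_y : Nat.Coprime x y := Nat.coprime_add_self_left.mp (by rw [hx]; exact cop_15u_y)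
  -- ¬ s ∣ x, hence gcd(x, Y) = 1
  have hsx : ¬ s ∣ x := by
    intro h
    have h16 : s ∣ 16 * u := by rw [← hxY]; exact dvd_add h (dvd_pow_self s (by norm_num))
    have cop_s_16 : Nat.Coprime s 16 := by
      have e : (16 : ℕ) = 2 ^ 4 := by norm_num
      rw [e]; exact Nat.Coprime.pow_right 4 ((Nat.coprime_primes hs Nat.prime_two).mpr (by omega))
    have hsu : s ∣ u := cop_s_16.dvd_of_dvd_mul_left h16
    have hsY : s ∣ u + y := by rw [hu]; exact dvd_pow_self s (by norm_num)
    exact hsy ((Nat.dvd_add_right hsu).mp hsY)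
  have cop_x_Y : Nat.Coprime x Y :=
    (Nat.Coprime.pow_left 4 ((Nat.Prime.coprime_iff_not_dvd hs).mpr hsx)).symm
  -- ¬ r ∣ y, hence gcd(X, y) = 1
  have hry : ¬ r ∣ y := by
    intro h
    have h15 : r ∣ 15 * W := by rw [← hyX]; exact dvd_add h (dvd_pow_self r (by norm_num))
    rcases (Nat.Prime.dvd_mul hr).mp h15 with h1 | h1
    · have h35 : r ∣ 3 * 5 := by simpa using h1
      rcases (Nat.Prime.dvd_mul hr).mp h35 with h2 | h2
      · have := (Nat.prime_dvd_prime_iff_eq hr Nat.prime_three).mp h2; omega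
      · have := (Nat.prime_dvd_prime_iff_eq hr (by norm_num)).mp h2; omega
    · have := (Nat.prime_dvd_prime_iff_eq hr hq).mp (hr.dvd_of_dvd_pow h1); omega
  have cop_X_y : Nat.Coprime X y := Nat.Coprime.pow_left 4 ((Nat.Prime.coprime_iff_not_dvd hr).mpr hry)
  -- auxiliary coprimalities for the splittings
  have h3u : ¬ 3 ∣ u := by omega
  have h5u : ¬ 5 ∣ u := by omega
  have h2u : ¬ 2 ∣ u := by omega
  have cop_15_u : Nat.Coprime 15 u :=
    Nat.Coprime.mul_left ((Nat.Prime.coprime_iff_not_dvd Nat.prime_three).mpr h3u)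
      ((Nat.Prime.coprime_iff_not_dvd (by norm_num)).mpr h5u)
  have cop_16_u : Nat.Coprime 16 u := by
    have e : (16 : ℕ) = 2 ^ 4 := by norm_num
    rw [e]; exact Nat.Coprime.pow_left 4 ((Nat.Prime.coprime_iff_not_dvd Nat.prime_two).mpr h2u)
  have cop_15_W : Nat.Coprime 15 W :=
    Nat.Coprime.mul_left
      (Nat.Coprime.pow_right 4 ((Nat.coprime_primes Nat.prime_three hq).mpr (by omega)))
      (Nat.Coprime.pow_right 4 ((Nat.coprime_primes (by norm_num : Nat.Prime 5) hq).mpr (by omega)))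
  have cop_x_15u : Nat.Coprime x (15 * u) := by
    rw [← hx]; exact Nat.coprime_self_add_right.mpr cop_x_y
  have cop_y_15u : Nat.Coprime y (15 * u) := by
    rw [← hx]; exact Nat.coprime_add_self_right.mpr cop_x_y.symm
  have cop_x_16u : Nat.Coprime x (16 * u) := by
    rw [← hxY]; exact Nat.coprime_self_add_right.mpr cop_x_Y
  have cop_Y_16u : Nat.Coprime Y (16 * u) := by
    rw [← hxY]; exact Nat.coprime_add_self_right.mpr cop_x_Y.symm
  have cop_X_15W : Nat.Coprime X (15 * W) := by
    rw [← hyX, add_comm]; exact Nat.coprime_self_add_right.mpr cop_X_y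
  have cop_y_15W : Nat.Coprime y (15 * W) := by
    rw [← hyX]; exact Nat.coprime_self_add_right.mpr cop_X_y.symm
  -- positivity of the members
  have hW0 : 0 < W := by omega
  have hY0 : 0 < Y := by omega
  have h15u : 0 < 15 * u := by omega
  have h16u : 0 < 16 * u := by omega
  have h15W : 0 < 15 * W := by omega
  -- Step 5: the table-independent window bounds and the modulus ℓ
  set Z₃ : ℝ := ∑ p ∈ (x * y * (15 * u)).primeFactors,
    K * (((x.factorization p + y.factorization p + (15 * u).factorization p : ℕ) : ℝ) + 1) *
      Real.log p with hZ₃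
  set Z₁ : ℝ := ∑ p ∈ (x * Y * (16 * u)).primeFactors,
    K * (((x.factorization p + Y.factorization p + (16 * u).factorization p : ℕ) : ℝ) + 1) *
      Real.log p with hZ₁
  set Z₂ : ℝ := ∑ p ∈ (X * y * (15 * W)).primeFactors,
    K * (((X.factorization p + y.factorization p + (15 * W).factorization p : ℕ) : ℝ) + 1) *
      Real.log p with hZ₂
  have hlogp : ∀ p : ℕ, 0 ≤ Real.log p := fun p => Real.log_natCast_nonneg p
  have hZ₃0 : 0 ≤ Z₃ :=
    Finset.sum_nonneg fun p _ => mul_nonneg (mul_nonneg hK0 (by positivity)) (hlogp p)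
  have hZ₁0 : 0 ≤ Z₁ :=
    Finset.sum_nonneg fun p _ => mul_nonneg (mul_nonneg hK0 (by positivity)) (hlogp p)
  have hZ₂0 : 0 ≤ Z₂ :=
    Finset.sum_nonneg fun p _ => mul_nonneg (mul_nonneg hK0 (by positivity)) (hlogp p)
  set P₃ : ℕ := x * y * (15 * u) with hP₃
  set P₁ : ℕ := x * Y * (16 * u) with hP₁
  set P₂ : ℕ := X * y * (15 * W) with hP₂
  have hP₃0 : 0 < P₃ := Nat.mul_pos (Nat.mul_pos hx0 hy0) h15u
  have hP₁0 : 0 < P₁ := Nat.mul_pos (Nat.mul_pos hx0 hY0) h16u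
  have hP₂0 : 0 < P₂ := Nat.mul_pos (Nat.mul_pos hX0 hy0) h15W
  obtain ⟨ℓ, hℓge, hℓp⟩ :=
    Nat.exists_infinite_primes (P₁ + P₂ + P₃ + m₀ + 5 + ⌈Z₁ + Z₂ + Z₃ + c₃⌉₊ + 1)
  have h5 : 5 ≤ ℓ := by omega
  have hm₀ : m₀ ≤ ℓ ^ 1 := by rw [pow_one]; omega
  have hℓR : Z₁ + Z₂ + Z₃ + c₃ < ((ℓ ^ 1 : ℕ) : ℝ) := by
    have h1 : ((⌈Z₁ + Z₂ + Z₃ + c₃⌉₊ : ℕ) : ℝ) + 1 ≤ (ℓ : ℝ) := by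
      exact_mod_cast (show ⌈Z₁ + Z₂ + Z₃ + c₃⌉₊ + 1 ≤ ℓ by omega)
    rw [pow_one]
    linarith [Nat.le_ceil (Z₁ + Z₂ + Z₃ + c₃)]
  have hnd₃ : ¬ ℓ ∣ P₃ := Nat.not_dvd_of_pos_of_lt hP₃0 (by omega)
  have hnd₁ : ¬ ℓ ∣ P₁ := Nat.not_dvd_of_pos_of_lt hP₁0 (by omega)
  have hnd₂ : ¬ ℓ ∣ P₂ := Nat.not_dvd_of_pos_of_lt hP₂0 (by omega)
  -- Step 6: the table at modulus ℓ and the three triples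
  obtain ⟨t, ht, hT⟩ := H ℓ 1 hℓp h5 hm₀
  obtain ⟨B₃, hB₃, hc₃'⟩ := hT x y (15 * u) ⟨hx0, hy0, hx, cop_x_y⟩
    (bal (by omega)) (bal (by omega)) hnd₃
  obtain ⟨B₁, hB₁, hc₁'⟩ := hT x Y (16 * u) ⟨hx0, hY0, hxY, cop_x_Y⟩
    (bal (by omega)) (bal (by omega)) hnd₁
  obtain ⟨B₂, hB₂, hc₂'⟩ := hT X y (15 * W) ⟨hX0, hy0, by omega, cop_X_y⟩
    (bal (by omega)) (bal (by omega)) hnd₂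
  -- upper windows with the nonnegative constant K
  have hKt : ∀ p i j k : ℕ, p.Prime →
      |(t p i j k : ℝ)| ≤ K * (((i + j + k : ℕ) : ℝ) + 1) * Real.log p := by
    intro p i j k hp
    refine ((ht p i j k hp).2).trans ?_
    exact mul_le_mul_of_nonneg_right (mul_le_mul_of_nonneg_right hK1 (by positivity)) (hlogp p)
  -- Step 7: decompositions of the three sums
  set SA : ℤ := ∑ p ∈ x.primeFactors, t p (x.factorization p) 0 0 with hSA
  set SB : ℤ := ∑ p ∈ y.primeFactors, t p 0 (y.factorization p) 0 with hSB
  set SU : ℤ := ∑ p ∈ u.primeFactors, t p 0 0 (u.factorization p) with hSU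
  have hS₃ : ∑ p ∈ (x * y * (15 * u)).primeFactors,
      t p (x.factorization p) (y.factorization p) ((15 * u).factorization p)
        = SA + SB + (t 3 0 0 1 + t 5 0 0 1 + SU) := by
    rw [sum_primeFactors_triple t hx0 hy0 h15u cop_x_y cop_x_15u cop_y_15u]
    have h := sum_primeFactors_mul_coprime (fun p k => t p 0 0 k) (by norm_num : (0:ℕ) < 15) hu0
      cop_15_u
    have h' := sum_primeFactors_fifteen (fun p k => t p 0 0 k)
    rw [h, h']
  have hS₁ : ∑ p ∈ (x * Y * (16 * u)).primeFactors,
      t p (x.factorization p) (Y.factorization p) ((16 * u).factorization p)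
        = SA + t s 0 4 0 + (t 2 0 0 4 + SU) := by
    rw [sum_primeFactors_triple t hx0 hY0 h16u cop_x_Y cop_x_16u cop_Y_16u]
    have h := sum_primeFactors_mul_coprime (fun p k => t p 0 0 k) (by norm_num : (0:ℕ) < 16) hu0
      cop_16_u
    have hB := sum_primeFactors_prime_pow (fun p k => t p 0 k 0) hs (by norm_num : (4:ℕ) ≠ 0)
    have hC := sum_primeFactors_prime_pow (fun p k => t p 0 0 k) Nat.prime_two (by norm_num : (4:ℕ) ≠ 0)
    have e16 : (16 : ℕ) = 2 ^ 4 := by norm_num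
    rw [h, hB]
    conv_lhs => rw [e16, hC]
  have hS₂ : ∑ p ∈ (X * y * (15 * W)).primeFactors,
      t p (X.factorization p) (y.factorization p) ((15 * W).factorization p)
        = t r 4 0 0 + SB + (t 3 0 0 1 + t 5 0 0 1 + t q 0 0 4) := by
    rw [sum_primeFactors_triple t hX0 hy0 h15W cop_X_y cop_X_15W cop_y_15W]
    have h := sum_primeFactors_mul_coprime (fun p k => t p 0 0 k) (by norm_num : (0:ℕ) < 15) hW0
      cop_15_W
    have hF := sum_primeFactors_fifteen (fun p k => t p 0 0 k)
    have hXs := sum_primeFactors_prime_pow (fun p k => t p k 0 0) hr (by norm_num : (4:ℕ) ≠ 0)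
    have hWs := sum_primeFactors_prime_pow (fun p k => t p 0 0 k) hq (by norm_num : (4:ℕ) ≠ 0)
    rw [h, hF, hXs, hWs]
  rw [hS₃] at hc₃'
  rw [hS₁] at hc₁'
  rw [hS₂] at hc₂'
  -- Step 8: congruence to equality
  have hA₃ := abs_tableSum_le hKt x y (15 * u)
  have hA₁ := abs_tableSum_le hKt x Y (16 * u)
  have hA₂ := abs_tableSum_le hKt X y (15 * W)
  rw [hS₃] at hA₃
  rw [hS₁] at hA₁
  rw [hS₂] at hA₂
  have hE₃ : SA + SB + (t 3 0 0 1 + t 5 0 0 1 + SU) = B₃ := by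
    refine CompactBalanceTransfer.Negative.eq_of_modEq_of_abs_le hc₃' (X := Z₃) (Y := c₃) hA₃ hB₃ ?_
    linarith only [hℓR, hZ₁0, hZ₂0, hZ₃0]
  have hE₁ : SA + t s 0 4 0 + (t 2 0 0 4 + SU) = B₁ := by
    refine CompactBalanceTransfer.Negative.eq_of_modEq_of_abs_le hc₁' (X := Z₁) (Y := c₃) hA₁ hB₁ ?_
    linarith only [hℓR, hZ₁0, hZ₂0, hZ₃0]
  have hE₂ : t r 4 0 0 + SB + (t 3 0 0 1 + t 5 0 0 1 + t q 0 0 4) = B₂ := by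
    refine CompactBalanceTransfer.Negative.eq_of_modEq_of_abs_le hc₂' (X := Z₂) (Y := c₃) hA₂ hB₂ ?_
    linarith only [hℓR, hZ₁0, hZ₂0, hZ₃0]
  -- elimination of the shared sums
  have hElimZ : t s 0 4 0 + t 2 0 0 4 + t r 4 0 0 + t q 0 0 4 = B₁ + B₂ - B₃ := by
    linear_combination hE₁ + hE₂ - hE₃
  have hElim : ((t s 0 4 0 : ℤ) : ℝ) + t 2 0 0 4 + t r 4 0 0 + t q 0 0 4 = B₁ + B₂ - B₃ := by
    exact_mod_cast hElimZ
  -- Step 9: lower windows at valuation 4 and the contradiction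
  have e4 : ∀ p : ℕ, c₁ * (2 * ((4 : ℕ) : ℝ) - 6 - ε) * Real.log p = c₁ * (2 - ε) * Real.log p := by
    intro p; push_cast; ring
  have hls : c₁ * (2 - ε) * Real.log s ≤ ((t s 0 4 0 : ℤ) : ℝ) := by
    have h := (ht s 0 4 0 hs).1; rwa [e4 s] at h
  have hl2 : c₁ * (2 - ε) * Real.log (2 : ℕ) ≤ ((t 2 0 0 4 : ℤ) : ℝ) := by
    have h := (ht 2 0 0 4 Nat.prime_two).1; rwa [e4 2] at h
  have hlr : c₁ * (2 - ε) * Real.log r ≤ ((t r 4 0 0 : ℤ) : ℝ) := by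
    have h := (ht r 4 0 0 hr).1; rwa [e4 r] at h
  have hlq : c₁ * (2 - ε) * Real.log q ≤ ((t q 0 0 4 : ℤ) : ℝ) := by
    have h := (ht q 0 0 4 hq).1; rwa [e4 q] at h
  have hps : 0 ≤ c₁ * (2 - ε) * Real.log s := mul_nonneg hcε.le (hlogp s)
  have hp2 : 0 ≤ c₁ * (2 - ε) * Real.log (2 : ℕ) := mul_nonneg hcε.le (hlogp 2)
  have hpq : 0 ≤ c₁ * (2 - ε) * Real.log q := mul_nonneg hcε.le (hlogp q)
  have hB₁' := (abs_le.mp hB₁).2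
  have hB₂' := (abs_le.mp hB₂).2
  have hB₃' := (abs_le.mp hB₃).1
  linarith only [hls, hl2, hlr, hlq, hps, hp2, hpq, hElim, hr3A, hB₁', hB₂', hB₃']

/-- **No residue-free tame-local receptacle.** The RESIDUE-FREE strengthening of
`Summit.ABC.ABC.Theses.CongruentialReceptacle.TameLocalReceptacle` (stmt-ABC-14354, the typed face of
crux `ReceptacleIdentity`, stmt-ABC-1813) — the same statement for integer tables
`t(p; v_p a, v_p b, v_p c)` that do not see the unit residues `a′, b′, c′ mod p` — is false. Hence every
witness of `TameLocalReceptacle` must use the residues, already on the `2⁻²⁵`-balanced cell and for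
every `ε < 2`; by `tameLocal_residueFree_false` the obstruction is a three-triple certificate, not an
averaging argument. [folklore] -/
theorem not_tameLocalReceptacle_residueFree :
    ¬ (∀ κ : ℝ, 0 < κ → ∀ ε : ℝ, 0 < ε → ∃ c₁ c₁' c₃ : ℝ, 0 < c₁ ∧ ∃ m₀ : ℕ, ∀ ℓ n : ℕ, ℓ.Prime →
      5 ≤ ℓ → m₀ ≤ ℓ ^ n → ∃ t : ℕ → ℕ → ℕ → ℕ → ℤ,
        (∀ p i j k : ℕ, p.Prime →
          c₁ * (2 * ((i + j + k : ℕ) : ℝ) - 6 - ε) * Real.log p ≤ (t p i j k : ℝ) ∧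
          |(t p i j k : ℝ)| ≤ c₁' * (((i + j + k : ℕ) : ℝ) + 1) * Real.log p) ∧
        ∀ a b c : ℕ, IsABCTriple a b c → κ * (c : ℝ) ≤ (a : ℝ) → κ * (c : ℝ) ≤ (b : ℝ) →
          ¬ ℓ ∣ a * b * c → ∃ B : ℤ, |(B : ℝ)| ≤ c₃ ∧
            (∑ p ∈ (a * b * c).primeFactors,
              t p (a.factorization p) (b.factorization p) (c.factorization p)) ≡
              B [ZMOD ((ℓ ^ n : ℕ) : ℤ)]) := by
  intro h
  obtain ⟨c₁, c₁', c₃, hc₁, m₀, H⟩ := h (1 / 2 ^ 25) (by positivity) 1 one_pos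
  exact tameLocal_residueFree_false (1 / 2 ^ 25) 1 c₁ c₁' c₃ le_rfl (by norm_num) hc₁ m₀ H

end Summit.ABC.ABC.Theorems.ReceptacleIdentity.Negative
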